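import Summits.KontsevichZagierPeriods.Zeta5Search.Barrier.ConeGammaCuspSymmetricDForm

/-!
# ζ(5) search — BARRIER: THE JUMP FORM — a junction's vote is an integer combination of its member flip times

HONEST FRAMING (cell `pub-zeta5`): systematic search; no irrationality claim unless kernel-certified. MODEL objects
under Brown–Zudilin's (28)+(30) accounting ([BZ22] = arXiv:2210.03391; (28) observed, not proved); nothing here is a
statement about `ζ(5)`, any `γ` of record, the cone's supremum (C2 OPEN) or the VALUE of any jump at a named direction
(DATA of the cell); S-E stays CONJECTURED; records in print UNMOVED. Prover P2 g27, companion of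
`ConeGammaCuspSymmetricDForm` (item (a) of P2 g26's successor menu; plan INBOX 2026-08-27 l.9273).

`germ_symm_eq_sum_cells` writes the vote of a junction `b` as `R_b(δ) = Σ_{j<n} (c_{j+1} − c_j)·D_j` over the cells of any
partition `−W = c_0 < ⋯ < c_n = W` through the member flip points, `D_j` the pattern defect of cell `j`, with
`D_0 = D_{n−1} = 0` (`reflDefect_cell_first` / `_last`). Abel summation turns this into the JUMP FORM, and WALL
ORIENTATION (`torusN_sub_le_oriented`) bounds every jump:
* **`abs_reflDefect_sub_le_card`** — two small displacements `Δ ≤ Δ'` (member forms non-zero, weakly increasing from `Δ`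
  to `Δ'`) at `b ∈ bkpts a T`: `|[𝒩(θ_b+Δ') + 𝒩(θ_b−Δ')] − [𝒩(θ_b+Δ) + 𝒩(θ_b−Δ)]| ≤ #S` for any finset `S` containing the
  members that FLIP (negative at `Δ`, positive at `Δ'`): their floors go up by one in `θ_b + ·` and down by one in
  `θ_b − ·`, so the favourable counts of the two brackets add up to `#S` (generalises g26's `abs_reflDefect_le_card`, the
  case `Δ' =` line step); **`abs_reflDefect_line_sub_le_card`** — the same along the local line, `x ≤ y` in `[−W, W]`;
* `sum_cells_abel` — `Σ_{j<n} (c_{j+1} − c_j) D_j = Σ_{0<i<n} c_i (D_{i−1} − D_i) + c_n D_{n−1} − c_0 D_0`;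
* **`germ_symm_eq_sum_jumps` — THE JUMP FORM**: `R_b(δ) = Σ_{0<i<n} c_i · (D_{i−1} − D_i)`;
* **`abs_jump_le_card`** — `|D_i − D_{i−1}| ≤ #{members whose flip point is c_i}` (`0 < i < n`), and
  **`jump_simple_mem`** — at a SIMPLE flip point (one member) `D_i − D_{i−1} ∈ {−1, 0, +1}`;
* **`germ_symm_eq_intComb`** — `R_b(δ) = Σ_{0<i<n} c_i · J_i` with INTEGERS `J_i`, `|J_i| ≤ m_i` (the multiplicity of
  the flip point `c_i`) and `Σ_i J_i = 0`: the vote is an integer combination of the distinct member flip times with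
  zero-sum coefficients bounded by the multiplicities; hence **`abs_germ_symm_le_weighted_spread`** —
  `|R_b(δ)| ≤ Σ_{0<i<n} |c_i − p|·m_i` for EVERY pivot `p`: g26's spread bound, recovered from the exact form.
DESK (DATA, `HOME/pub-zeta5-p2/g27/alg/dform.py`, exact): 0 violations of the jump law at 12,143 junction × displacement
pairs of record/41, flag/60, argmax-120, t*/480; simple-flip jumps `{−1, 0, +1}` with 56–68 % silent (`J = 0`); ties
never exceed `|J| = 2`. NOT here (honest): the value of any jump at a named direction; anything about `γ`, C2, S-E, `ζ(5)`.
-/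

noncomputable section

open Set MeasureTheory
open scoped Topology

namespace Summit.KontsevichZagierPeriods.Zeta5Search.Barrier.ConeGamma

/-! ### The jump between two patterns: wall orientation -/

/-- **TWO PATTERNS, ONE FLIP SET.** Let `b ∈ bkpts a T` and `Δ, Δ'` two displacements with forms `< 1` and
`< wallDist a T`, whose MEMBER forms (`b·h_k(a) ∈ ℤ`) are non-zero and weakly increase from `Δ` to `Δ'`, and let `S` be any
finset containing every member that flips (`φ_k(Δ) < 0 < φ_k(Δ')`). Then
`|[𝒩(θ_b+Δ') + 𝒩(θ_b−Δ')] − [𝒩(θ_b+Δ) + 𝒩(θ_b−Δ)]| ≤ #S` (`θ_b = b·s(a)`; this is the difference of the two reflection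
DEFECTS — the common baseline cancels): from `θ_b+Δ` to `θ_b+Δ'` exactly the flipping
floors go UP by one, from `θ_b−Δ` to `θ_b−Δ'` they go DOWN by one, nothing else moves; by the oriented Lipschitz bound the
first bracket lies in `[−#(S∖F), #(S∩F)]` and the second in `[−#(S∩F), #(S∖F)]`. -/
theorem abs_reflDefect_sub_le_card {a : Dir} {T b : ℝ} (hb : b ∈ bkpts a T) {Δ Δ' : Fin 8 → ℝ}
    (hΔ1 : ∀ k, |phiForm Δ k| < 1) (hΔ2 : ∀ k, |phiForm Δ k| < wallDist a T)
    (hΔ'1 : ∀ k, |phiForm Δ' k| < 1) (hΔ'2 : ∀ k, |phiForm Δ' k| < wallDist a T)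
    (hnz : ∀ k, (∃ z : ℤ, b * h28 a k = z) → phiForm Δ k ≠ 0 ∧ phiForm Δ' k ≠ 0)
    (hle : ∀ k, (∃ z : ℤ, b * h28 a k = z) → phiForm Δ k ≤ phiForm Δ' k)
    {S : Finset (Fin 28)}
    (hS : ∀ k, (∃ z : ℤ, b * h28 a k = z) → phiForm Δ k < 0 → 0 < phiForm Δ' k → k ∈ S) :
    |((torusN (b • sParam a + Δ') : ℝ) + torusN (b • sParam a - Δ')) -
        ((torusN (b • sParam a + Δ) : ℝ) + torusN (b • sParam a - Δ))| ≤ S.card := by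
  have eM : b • sParam a - Δ = b • sParam a + -Δ := sub_eq_add_neg _ _
  have eM' : b • sParam a - Δ' = b • sParam a + -Δ' := sub_eq_add_neg _ _
  have hn1 : ∀ k, |phiForm (-Δ) k| < 1 := fun k => by rw [phiForm_neg, abs_neg]; exact hΔ1 k
  have hn2 : ∀ k, |phiForm (-Δ) k| < wallDist a T := fun k => by rw [phiForm_neg, abs_neg]; exact hΔ2 k
  have hn1' : ∀ k, |phiForm (-Δ') k| < 1 := fun k => by rw [phiForm_neg, abs_neg]; exact hΔ'1 k
  have hn2' : ∀ k, |phiForm (-Δ') k| < wallDist a T := fun k => by rw [phiForm_neg, abs_neg]; exact hΔ'2 k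
  have fP := fun k => floor_phiForm_bkpt_add hb hΔ1 hΔ2 k
  have fP' := fun k => floor_phiForm_bkpt_add hb hΔ'1 hΔ'2 k
  have fM := fun k => floor_phiForm_bkpt_add hb hn1 hn2 k
  have fM' := fun k => floor_phiForm_bkpt_add hb hn1' hn2' k
  -- pointwise: the four increments entering the oriented bounds
  have hpt : ∀ k,
      max (⌊phiForm (b • sParam a + Δ') k⌋ - ⌊phiForm (b • sParam a + Δ) k⌋) 0 ≤ (if k ∈ S then (1 : ℤ) else 0) ∧
      max (⌊phiForm (b • sParam a + Δ) k⌋ - ⌊phiForm (b • sParam a + Δ') k⌋) 0 = 0 ∧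
      max (⌊phiForm (b • sParam a + -Δ') k⌋ - ⌊phiForm (b • sParam a + -Δ) k⌋) 0 = 0 ∧
      max (⌊phiForm (b • sParam a + -Δ) k⌋ - ⌊phiForm (b • sParam a + -Δ') k⌋) 0 ≤
        (if k ∈ S then (1 : ℤ) else 0) := by
    intro k
    have hind : (0 : ℤ) ≤ if k ∈ S then (1 : ℤ) else 0 := by split_ifs <;> norm_num
    by_cases hm : ∃ z : ℤ, b * h28 a k = z
    · obtain ⟨z, hz⟩ := hm
      obtain ⟨hz1, hz2⟩ := hnz k ⟨z, hz⟩
      rcases lt_or_gt_of_ne hz1 with hneg | hposk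
      · have rP : ⌊phiForm (b • sParam a + Δ) k⌋ = z - 1 := (fP k).2.1 z hz hneg
        have rM : ⌊phiForm (b • sParam a + -Δ) k⌋ = z := (fM k).1 z hz (by rw [phiForm_neg]; linarith)
        rcases lt_or_gt_of_ne hz2 with hneg' | hpos'
        · -- negative at both
          have rP' : ⌊phiForm (b • sParam a + Δ') k⌋ = z - 1 := (fP' k).2.1 z hz hneg'
          have rM' : ⌊phiForm (b • sParam a + -Δ') k⌋ = z :=
            (fM' k).1 z hz (by rw [phiForm_neg]; linarith)
          rw [rP, rM, rP', rM']
          refine ⟨by simp [hind], by simp, by simp, by simp [hind]⟩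
        · -- the member flips: `k ∈ S`
          have hkS : k ∈ S := hS k ⟨z, hz⟩ hneg hpos'
          have rP' : ⌊phiForm (b • sParam a + Δ') k⌋ = z := (fP' k).1 z hz hpos'
          have rM' : ⌊phiForm (b • sParam a + -Δ') k⌋ = z - 1 :=
            (fM' k).2.1 z hz (by rw [phiForm_neg]; linarith)
          rw [rP, rM, rP', rM', if_pos hkS]
          refine ⟨by simp, by simp, by simp, by simp⟩
      · -- positive at `Δ`, hence at `Δ'`
        have hpos' : 0 < phiForm Δ' k := hposk.trans_le (hle k ⟨z, hz⟩)
        have rP : ⌊phiForm (b • sParam a + Δ) k⌋ = z := (fP k).1 z hz hposk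
        have rM : ⌊phiForm (b • sParam a + -Δ) k⌋ = z - 1 := (fM k).2.1 z hz (by rw [phiForm_neg]; linarith)
        have rP' : ⌊phiForm (b • sParam a + Δ') k⌋ = z := (fP' k).1 z hz hpos'
        have rM' : ⌊phiForm (b • sParam a + -Δ') k⌋ = z - 1 :=
          (fM' k).2.1 z hz (by rw [phiForm_neg]; linarith)
        rw [rP, rM, rP', rM']
        refine ⟨by simp [hind], by simp, by simp, by simp [hind]⟩
    · push Not at hm
      rw [(fP k).2.2 hm, (fP' k).2.2 hm, (fM k).2.2 hm, (fM' k).2.2 hm]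
      refine ⟨by simp [hind], by simp, by simp, by simp [hind]⟩
  -- the four oriented bounds
  have hU1 := torusN_sub_le_oriented (b • sParam a + Δ) (b • sParam a + Δ')
  have hL1 := oriented_le_torusN_sub (b • sParam a + Δ) (b • sParam a + Δ')
  have hU2 := torusN_sub_le_oriented (b • sParam a + -Δ) (b • sParam a + -Δ')
  have hL2 := oriented_le_torusN_sub (b • sParam a + -Δ) (b • sParam a + -Δ')
  have b1 : ∀ s : Finset (Fin 28),
      ∑ k ∈ s, max (⌊phiForm (b • sParam a + Δ') k⌋ - ⌊phiForm (b • sParam a + Δ) k⌋) 0 ≤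
        ∑ k ∈ s, (if k ∈ S then (1 : ℤ) else 0) := fun s => Finset.sum_le_sum fun k _ => (hpt k).1
  have z2 : ∀ s : Finset (Fin 28),
      ∑ k ∈ s, max (⌊phiForm (b • sParam a + Δ) k⌋ - ⌊phiForm (b • sParam a + Δ') k⌋) 0 = 0 :=
    fun s => Finset.sum_eq_zero fun k _ => (hpt k).2.1
  have z3 : ∀ s : Finset (Fin 28),
      ∑ k ∈ s, max (⌊phiForm (b • sParam a + -Δ') k⌋ - ⌊phiForm (b • sParam a + -Δ) k⌋) 0 = 0 :=
    fun s => Finset.sum_eq_zero fun k _ => (hpt k).2.2.1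
  have b4 : ∀ s : Finset (Fin 28),
      ∑ k ∈ s, max (⌊phiForm (b • sParam a + -Δ) k⌋ - ⌊phiForm (b • sParam a + -Δ') k⌋) 0 ≤
        ∑ k ∈ s, (if k ∈ S then (1 : ℤ) else 0) := fun s => Finset.sum_le_sum fun k _ => (hpt k).2.2.2
  have hcard := sum_indicator_FIdx_add_compl S
  have hZ : -(S.card : ℤ) ≤ (torusN (b • sParam a + Δ') + torusN (b • sParam a + -Δ')) -
        (torusN (b • sParam a + Δ) + torusN (b • sParam a + -Δ)) ∧
      (torusN (b • sParam a + Δ') + torusN (b • sParam a + -Δ')) -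
        (torusN (b • sParam a + Δ) + torusN (b • sParam a + -Δ)) ≤ S.card := by
    have := b1 FIdx; have := b1 FIdxᶜ; have := z2 FIdx; have := z2 FIdxᶜ
    have := z3 FIdx; have := z3 FIdxᶜ; have := b4 FIdx; have := b4 FIdxᶜ
    constructor <;> linarith
  have hR1 : (-(S.card : ℤ) : ℝ) ≤ (((torusN (b • sParam a + Δ') + torusN (b • sParam a + -Δ')) -
      (torusN (b • sParam a + Δ) + torusN (b • sParam a + -Δ)) : ℤ) : ℝ) := by exact_mod_cast hZ.1
  have hR2 : (((torusN (b • sParam a + Δ') + torusN (b • sParam a + -Δ')) -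
      (torusN (b • sParam a + Δ) + torusN (b • sParam a + -Δ)) : ℤ) : ℝ) ≤ ((S.card : ℤ) : ℝ) := by
    exact_mod_cast hZ.2
  rw [eM, eM', abs_le]
  push_cast at hR1 hR2
  exact ⟨hR1, hR2⟩

/-- **THE JUMP BOUND ALONG THE LOCAL LINE.** For `x ≤ y` in `[−W, W]` at which no member form vanishes, and any finset
`S` containing the members whose form is negative at `x` and positive at `y` (flip point in between):
`|P(y) − P(x)| ≤ #S`, `P` the reflection defect of the line (`0 < η`, `ηK < 1`, `ηK < wallDist`). -/
theorem abs_reflDefect_line_sub_le_card {a : Dir} (hpos : ∀ k, 0 < h28 a k) {T b : ℝ} (hb : b ∈ bkpts a T)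
    (δ : Fin 8 → ℝ) {η : ℝ} (hη : 0 < η) (h1 : η * clusterBound a δ < 1) (h2 : η * clusterBound a δ < wallDist a T)
    (t : ℝ) {x y : ℝ} (hxy : x ≤ y) (hx : |x| ≤ clusterWidth a δ) (hy : |y| ≤ clusterWidth a δ)
    (hnz : ∀ k, (∃ z : ℤ, b * h28 a k = z) → x * h28 a k + phiForm δ k ≠ 0 ∧ y * h28 a k + phiForm δ k ≠ 0)
    {S : Finset (Fin 28)}
    (hS : ∀ k, (∃ z : ℤ, b * h28 a k = z) → x * h28 a k + phiForm δ k < 0 → 0 < y * h28 a k + phiForm δ k → k ∈ S) :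
    |((torusN (b • sParam a + η • (y • sParam a + δ)) : ℝ) + torusN (b • sParam a - η • (y • sParam a + δ)) -
          (torusN (b • sParam a + t • sParam a) + torusN (b • sParam a - t • sParam a))) -
        ((torusN (b • sParam a + η • (x • sParam a + δ)) : ℝ) + torusN (b • sParam a - η • (x • sParam a + δ)) -
          (torusN (b • sParam a + t • sParam a) + torusN (b • sParam a - t • sParam a)))| ≤ S.card := by
  obtain ⟨hx1, hx2⟩ := disp_small hpos δ hη h1 h2 hx (T := T)
  obtain ⟨hy1, hy2⟩ := disp_small hpos δ hη h1 h2 hy (T := T)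
  have h := abs_reflDefect_sub_le_card hb hx1 hx2 hy1 hy2
    (fun k hk => by
      rw [phiForm_disp, phiForm_disp]
      exact ⟨mul_ne_zero hη.ne' (hnz k hk).1, mul_ne_zero hη.ne' (hnz k hk).2⟩)
    (fun k _ => by
      rw [phiForm_disp, phiForm_disp]
      exact mul_le_mul_of_nonneg_left (by nlinarith [hpos k]) hη.le)
    (S := S) (fun k hk hn hp => by
      rw [phiForm_disp] at hn hp
      exact hS k hk (lt_of_mul_lt_mul_left (by rwa [mul_zero]) hη.le)
        (lt_of_mul_lt_mul_left (by rwa [mul_zero]) hη.le))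
  have e : ((torusN (b • sParam a + η • (y • sParam a + δ)) : ℝ) + torusN (b • sParam a - η • (y • sParam a + δ)) -
          (torusN (b • sParam a + t • sParam a) + torusN (b • sParam a - t • sParam a))) -
        ((torusN (b • sParam a + η • (x • sParam a + δ)) : ℝ) + torusN (b • sParam a - η • (x • sParam a + δ)) -
          (torusN (b • sParam a + t • sParam a) + torusN (b • sParam a - t • sParam a))) =
      ((torusN (b • sParam a + η • (y • sParam a + δ)) : ℝ) + torusN (b • sParam a - η • (y • sParam a + δ))) -
        ((torusN (b • sParam a + η • (x • sParam a + δ)) : ℝ) + torusN (b • sParam a - η • (x • sParam a + δ))) := by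
    ring
  rw [e]
  exact h

/-! ### Abel summation: THE JUMP FORM -/

/-- **Abel summation over the cells**: for `1 ≤ n`,
`Σ_{j<n} (c_{j+1} − c_j)·D_j = Σ_{0<i<n} c_i·(D_{i−1} − D_i) + c_n·D_{n−1} − c_0·D_0`. -/
theorem sum_cells_abel (c D : ℕ → ℝ) {n : ℕ} (hn : 1 ≤ n) :
    ∑ j ∈ Finset.range n, (c (j + 1) - c j) * D j =
      ∑ i ∈ Finset.Ico 1 n, c i * (D (i - 1) - D i) + c n * D (n - 1) - c 0 * D 0 := by
  induction n, hn using Nat.le_induction with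
  | base =>
    rw [Finset.sum_range_one, Finset.Ico_self, Finset.sum_empty, Nat.sub_self]
    ring
  | succ m hm ih =>
    rw [Finset.sum_range_succ, ih, Finset.sum_Ico_succ_top hm, Nat.add_sub_cancel]
    ring

/-- **THE JUMP FORM.** Under the hypotheses of `germ_symm_eq_sum_cells` with `0 < n` (a partition
`−W = c_0 < ⋯ < c_n = W` through every member flip point), writing `D_j = P((c_j + c_{j+1})/2)` for the pattern defect of
cell `j`: `germR(δ) + germL(δ) + germR(−δ) + germL(−δ) = Σ_{0<i<n} c_i · (D_{i−1} − D_i)` — the vote is the sum over the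
interior partition points of (flip time) × (jump of the defect across it); points `c_i` that are not member flip points
have jump `0` (`abs_jump_le_card` with `S = ∅`). -/
theorem germ_symm_eq_sum_jumps {a : Dir} (hpos : ∀ k, 0 < h28 a k) {T b : ℝ} (hb : b ∈ bkpts a T)
    (δ : Fin 8 → ℝ) {η : ℝ} (hη : 0 < η) (h1 : η * clusterBound a δ < 1) (h2 : η * clusterBound a δ < wallDist a T)
    {t : ℝ} (ht : 0 < t) (ht1 : t * xMax a < 1) (ht2 : t * xMax a < wallDist a T)
    {n : ℕ} {c : ℕ → ℝ} (hn : 0 < n) (hc0 : c 0 = -clusterWidth a δ) (hcn : c n = clusterWidth a δ)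
    (hmono : ∀ j < n, c j < c (j + 1))
    (hflip : ∀ k, (∃ z : ℤ, b * h28 a k = z) → ∃ i ≤ n, c i = -(phiForm δ k / h28 a k)) :
    germR a δ η b + germL a δ η b + germR a (-δ) η b + germL a (-δ) η b =
      ∑ i ∈ Finset.Ico 1 n, c i *
        (((torusN (b • sParam a + η • (((c (i - 1) + c i) / 2) • sParam a + δ)) : ℝ) +
              torusN (b • sParam a - η • (((c (i - 1) + c i) / 2) • sParam a + δ)) -
            (torusN (b • sParam a + t • sParam a) + torusN (b • sParam a - t • sParam a))) -
          ((torusN (b • sParam a + η • (((c i + c (i + 1)) / 2) • sParam a + δ)) : ℝ) +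
              torusN (b • sParam a - η • (((c i + c (i + 1)) / 2) • sParam a + δ)) -
            (torusN (b • sParam a + t • sParam a) + torusN (b • sParam a - t • sParam a)))) := by
  rw [germ_symm_eq_sum_cells hpos hb δ hη h1 h2 ht ht1 ht2 hc0 hcn hmono hflip,
    sum_cells_abel c (fun j => (torusN (b • sParam a + η • (((c j + c (j + 1)) / 2) • sParam a + δ)) : ℝ) +
        torusN (b • sParam a - η • (((c j + c (j + 1)) / 2) • sParam a + δ)) -
      (torusN (b • sParam a + t • sParam a) + torusN (b • sParam a - t • sParam a))) hn]
  have hF := reflDefect_cell_first hpos hb δ hη h1 h2 ht ht1 ht2 hn hc0 hcn hmono hflip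
  have hL := reflDefect_cell_last hpos hb δ hη h1 h2 ht ht1 ht2 hn hc0 hcn hmono hflip
  simp only [Nat.sub_add_cancel hn, zero_add] at hL ⊢
  rw [hF, hL, mul_zero, mul_zero, add_zero, sub_zero]
  exact Finset.sum_congr rfl fun i hi => by rw [Nat.sub_add_cancel (Finset.mem_Ico.mp hi).1]

/-! ### The size of a jump: multiplicity of the flip point -/

/-- **A JUMP IS AT MOST THE MULTIPLICITY OF ITS FLIP POINT.** Under the partition hypotheses, for `0 < i < n` and any
finset `S` containing every member whose flip point is `c_i` (`c_i = −φ_k(δ)/h_k(a)`): `|D_i − D_{i−1}| ≤ #S`. In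
particular a partition point that is no member's flip point has jump `0` (`S = ∅`). -/
theorem abs_jump_le_card {a : Dir} (hpos : ∀ k, 0 < h28 a k) {T b : ℝ} (hb : b ∈ bkpts a T)
    (δ : Fin 8 → ℝ) {η : ℝ} (hη : 0 < η) (h1 : η * clusterBound a δ < 1) (h2 : η * clusterBound a δ < wallDist a T)
    (t : ℝ) {n : ℕ} {c : ℕ → ℝ} (hc0 : c 0 = -clusterWidth a δ) (hcn : c n = clusterWidth a δ)
    (hmono : ∀ j < n, c j < c (j + 1))
    (hflip : ∀ k, (∃ z : ℤ, b * h28 a k = z) → ∃ i ≤ n, c i = -(phiForm δ k / h28 a k))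
    {i : ℕ} (hi0 : 0 < i) (hin : i < n) {S : Finset (Fin 28)}
    (hS : ∀ k, (∃ z : ℤ, b * h28 a k = z) → c i = -(phiForm δ k / h28 a k) → k ∈ S) :
    |((torusN (b • sParam a + η • (((c i + c (i + 1)) / 2) • sParam a + δ)) : ℝ) +
            torusN (b • sParam a - η • (((c i + c (i + 1)) / 2) • sParam a + δ)) -
          (torusN (b • sParam a + t • sParam a) + torusN (b • sParam a - t • sParam a))) -
        ((torusN (b • sParam a + η • (((c (i - 1) + c i) / 2) • sParam a + δ)) : ℝ) +
            torusN (b • sParam a - η • (((c (i - 1) + c i) / 2) • sParam a + δ)) -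
          (torusN (b • sParam a + t • sParam a) + torusN (b • sParam a - t • sParam a)))| ≤ S.card := by
  have hi1 : i - 1 < n := by omega
  have hlt0 : c (i - 1) < c i := by
    have := hmono (i - 1) hi1
    rwa [Nat.sub_add_cancel hi0] at this
  have hlt1 : c i < c (i + 1) := hmono i hin
  have hlo : -clusterWidth a δ ≤ c (i - 1) := by rw [← hc0]; exact chain_mono hmono (Nat.zero_le _) hi1.le
  have hhi : c (i + 1) ≤ clusterWidth a δ := by rw [← hcn]; exact chain_mono hmono (Nat.succ_le_of_lt hin) le_rfl
  have hxI : c (i - 1) < (c (i - 1) + c i) / 2 ∧ (c (i - 1) + c i) / 2 < c (i - 1 + 1) := by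
    rw [Nat.sub_add_cancel hi0]; exact ⟨by linarith, by linarith⟩
  have hyI : c i < (c i + c (i + 1)) / 2 ∧ (c i + c (i + 1)) / 2 < c (i + 1) := ⟨by linarith, by linarith⟩
  have hxW : |(c (i - 1) + c i) / 2| ≤ clusterWidth a δ := abs_le.mpr ⟨by linarith, by linarith⟩
  have hyW : |(c i + c (i + 1)) / 2| ≤ clusterWidth a δ := abs_le.mpr ⟨by linarith, by linarith⟩
  have sx := member_signs_on_cell hpos δ hmono hflip hi1 hxI hxI (b := b)
  have sy := member_signs_on_cell hpos δ hmono hflip hin hyI hyI (b := b)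
  refine abs_reflDefect_line_sub_le_card hpos hb δ hη h1 h2 t (by linarith) hxW hyW (fun k hk => ?_) fun k hk hn hp => ?_
  · exact ⟨by rcases sx k hk with ⟨h, -⟩ | ⟨h, -⟩; exacts [h.ne', h.ne],
      by rcases sy k hk with ⟨-, h⟩ | ⟨-, h⟩; exacts [h.ne', h.ne]⟩
  · -- the member flips between the two midpoints: its flip point is `c_i`
    have hk0 := hpos k
    obtain ⟨l, hln, hcl⟩ := hflip k hk
    rw [line_form_eq_mul_sub hk0 hcl] at hn hp
    have hn' : (c (i - 1) + c i) / 2 < c l := by nlinarith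
    have hp' : c l < (c i + c (i + 1)) / 2 := by nlinarith
    have hli : i ≤ l := by
      by_contra h
      have := chain_mono hmono (show l ≤ i - 1 by omega) hi1.le
      linarith
    have hil : l ≤ i := by
      by_contra h
      have := chain_mono hmono (show i + 1 ≤ l by omega) hln
      linarith
    exact hS k hk (by rw [le_antisymm hli hil]; exact hcl)

/-- **A SIMPLE FLIP HAS JUMP `−1`, `0` OR `+1`**: if at most one member has flip point `c_i` (`#S ≤ 1` in
`abs_jump_le_card`), then `D_i − D_{i−1} ∈ {−1, 0, +1}` (an integer of absolute value `≤ 1`). -/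
theorem jump_simple_mem {a : Dir} (hpos : ∀ k, 0 < h28 a k) {T b : ℝ} (hb : b ∈ bkpts a T)
    (δ : Fin 8 → ℝ) {η : ℝ} (hη : 0 < η) (h1 : η * clusterBound a δ < 1) (h2 : η * clusterBound a δ < wallDist a T)
    (t : ℝ) {n : ℕ} {c : ℕ → ℝ} (hc0 : c 0 = -clusterWidth a δ) (hcn : c n = clusterWidth a δ)
    (hmono : ∀ j < n, c j < c (j + 1))
    (hflip : ∀ k, (∃ z : ℤ, b * h28 a k = z) → ∃ i ≤ n, c i = -(phiForm δ k / h28 a k))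
    {i : ℕ} (hi0 : 0 < i) (hin : i < n) {S : Finset (Fin 28)} (hS1 : S.card ≤ 1)
    (hS : ∀ k, (∃ z : ℤ, b * h28 a k = z) → c i = -(phiForm δ k / h28 a k) → k ∈ S) :
    let J := ((torusN (b • sParam a + η • (((c i + c (i + 1)) / 2) • sParam a + δ)) : ℝ) +
            torusN (b • sParam a - η • (((c i + c (i + 1)) / 2) • sParam a + δ)) -
          (torusN (b • sParam a + t • sParam a) + torusN (b • sParam a - t • sParam a))) -
        ((torusN (b • sParam a + η • (((c (i - 1) + c i) / 2) • sParam a + δ)) : ℝ) +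
            torusN (b • sParam a - η • (((c (i - 1) + c i) / 2) • sParam a + δ)) -
          (torusN (b • sParam a + t • sParam a) + torusN (b • sParam a - t • sParam a)))
    J = -1 ∨ J = 0 ∨ J = 1 := by
  intro J
  have hJ := abs_jump_le_card hpos hb δ hη h1 h2 t hc0 hcn hmono hflip hi0 hin hS
  have hJ1 : |J| ≤ 1 := hJ.trans (by exact_mod_cast hS1)
  -- `J` is an integer
  set m : ℤ := (torusN (b • sParam a + η • (((c i + c (i + 1)) / 2) • sParam a + δ)) +
      torusN (b • sParam a - η • (((c i + c (i + 1)) / 2) • sParam a + δ))) -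
    (torusN (b • sParam a + η • (((c (i - 1) + c i) / 2) • sParam a + δ)) +
      torusN (b • sParam a - η • (((c (i - 1) + c i) / 2) • sParam a + δ))) with hm
  have hJm : J = (m : ℝ) := by
    show _ - _ = _
    rw [hm]; push_cast; ring
  rw [hJm] at hJ1 ⊢
  have h1' : ((-1 : ℤ) : ℝ) ≤ (m : ℝ) := by push_cast; linarith [(abs_le.mp hJ1).1]
  have h2' : (m : ℝ) ≤ ((1 : ℤ) : ℝ) := by push_cast; linarith [(abs_le.mp hJ1).2]
  have h1'' : (-1 : ℤ) ≤ m := by exact_mod_cast h1'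
  have h2'' : m ≤ 1 := by exact_mod_cast h2'
  rcases (show m = -1 ∨ m = 0 ∨ m = 1 by omega) with h | h | h <;> simp [h]

/-! ### The vote as an integer combination of the flip times -/

/-- **THE VOTE IS AN INTEGER COMBINATION OF THE DISTINCT MEMBER FLIP TIMES.** Under the partition hypotheses with
`0 < n`, and finsets `S i ⊇ {members with flip point c_i}`: there are INTEGERS `J_i` (`0 < i < n`) with `|J_i| ≤ #(S i)`,
`Σ_i J_i = 0`, and `germR(δ) + germL(δ) + germR(−δ) + germL(−δ) = Σ_{0<i<n} c_i · J_i` (`J_i = D_{i−1} − D_i`, the sum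
telescopes between the two outer cells, both of defect `0`). -/
theorem germ_symm_eq_intComb {a : Dir} (hpos : ∀ k, 0 < h28 a k) {T b : ℝ} (hb : b ∈ bkpts a T)
    (δ : Fin 8 → ℝ) {η : ℝ} (hη : 0 < η) (h1 : η * clusterBound a δ < 1) (h2 : η * clusterBound a δ < wallDist a T)
    {t : ℝ} (ht : 0 < t) (ht1 : t * xMax a < 1) (ht2 : t * xMax a < wallDist a T)
    {n : ℕ} {c : ℕ → ℝ} (hn : 0 < n) (hc0 : c 0 = -clusterWidth a δ) (hcn : c n = clusterWidth a δ)
    (hmono : ∀ j < n, c j < c (j + 1))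
    (hflip : ∀ k, (∃ z : ℤ, b * h28 a k = z) → ∃ i ≤ n, c i = -(phiForm δ k / h28 a k))
    {S : ℕ → Finset (Fin 28)}
    (hS : ∀ i, 0 < i → i < n → ∀ k, (∃ z : ℤ, b * h28 a k = z) → c i = -(phiForm δ k / h28 a k) → k ∈ S i) :
    ∃ J : ℕ → ℤ, (∀ i, 0 < i → i < n → |J i| ≤ (S i).card) ∧ ∑ i ∈ Finset.Ico 1 n, J i = 0 ∧
      germR a δ η b + germL a δ η b + germR a (-δ) η b + germL a (-δ) η b =
        ∑ i ∈ Finset.Ico 1 n, c i * (J i : ℝ) := by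
  -- the integer reflected pair of cell `j` and its jumps
  set p : ℕ → ℤ := fun j => torusN (b • sParam a + η • (((c j + c (j + 1)) / 2) • sParam a + δ)) +
    torusN (b • sParam a - η • (((c j + c (j + 1)) / 2) • sParam a + δ)) with hp
  refine ⟨fun i => p (i - 1) - p i, fun i hi0 hin => ?_, ?_, ?_⟩
  · -- size of the jump
    have h := abs_jump_le_card hpos hb δ hη h1 h2 t hc0 hcn hmono hflip hi0 hin (hS i hi0 hin)
    have e : ((torusN (b • sParam a + η • (((c i + c (i + 1)) / 2) • sParam a + δ)) : ℝ) +
            torusN (b • sParam a - η • (((c i + c (i + 1)) / 2) • sParam a + δ)) -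
          (torusN (b • sParam a + t • sParam a) + torusN (b • sParam a - t • sParam a))) -
        ((torusN (b • sParam a + η • (((c (i - 1) + c i) / 2) • sParam a + δ)) : ℝ) +
            torusN (b • sParam a - η • (((c (i - 1) + c i) / 2) • sParam a + δ)) -
          (torusN (b • sParam a + t • sParam a) + torusN (b • sParam a - t • sParam a))) =
        -(((p (i - 1) : ℤ) : ℝ) - ((p i : ℤ) : ℝ)) := by
      rw [hp]; simp only [Nat.sub_add_cancel hi0]; push_cast; ring
    rw [e, abs_neg] at h
    exact_mod_cast h
  · -- the jumps telescope between the two outer cells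
    rw [Finset.sum_Ico_eq_sum_range,
      Finset.sum_congr rfl fun k _ => by rw [Nat.add_sub_cancel_left, Nat.add_comm 1 k], Finset.sum_range_sub']
    have hF := reflDefect_cell_first hpos hb δ hη h1 h2 ht ht1 ht2 hn hc0 hcn hmono hflip
    have hL := reflDefect_cell_last hpos hb δ hη h1 h2 ht ht1 ht2 hn hc0 hcn hmono hflip
    have hF' : ((p 0 : ℤ) : ℝ) = torusN (b • sParam a + t • sParam a) + torusN (b • sParam a - t • sParam a) := by
      rw [hp]; push_cast; linarith
    have hL' : ((p (n - 1) : ℤ) : ℝ) = torusN (b • sParam a + t • sParam a) + torusN (b • sParam a - t • sParam a) := by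
      rw [hp]; simp only [Nat.sub_add_cancel hn]; push_cast; linarith
    have : ((p 0 - p (n - 1) : ℤ) : ℝ) = 0 := by push_cast; rw [hF', hL', sub_self]
    exact_mod_cast this
  · -- the jump form
    rw [germ_symm_eq_sum_jumps hpos hb δ hη h1 h2 ht ht1 ht2 hn hc0 hcn hmono hflip]
    refine Finset.sum_congr rfl fun i hi => ?_
    have hi0 : 0 < i := (Finset.mem_Ico.mp hi).1
    congr 1
    rw [hp]; simp only [Nat.sub_add_cancel hi0]; push_cast; ring

/-- **THE SPREAD BOUND, RECOVERED FROM THE EXACT FORM** (with multiplicities): under the same hypotheses, for EVERY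
pivot `q`, `|germR(δ) + germL(δ) + germR(−δ) + germL(−δ)| ≤ Σ_{0<i<n} |c_i − q| · #(S i)` — insert `q·Σ J_i = 0` into the
integer combination and bound each jump by its multiplicity (g26's `abs_germ_symm_le_spread` is the case of the exact
member flip multiset). -/
theorem abs_germ_symm_le_weighted_spread {a : Dir} (hpos : ∀ k, 0 < h28 a k) {T b : ℝ} (hb : b ∈ bkpts a T)
    (δ : Fin 8 → ℝ) {η : ℝ} (hη : 0 < η) (h1 : η * clusterBound a δ < 1) (h2 : η * clusterBound a δ < wallDist a T)
    {t : ℝ} (ht : 0 < t) (ht1 : t * xMax a < 1) (ht2 : t * xMax a < wallDist a T)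
    {n : ℕ} {c : ℕ → ℝ} (hn : 0 < n) (hc0 : c 0 = -clusterWidth a δ) (hcn : c n = clusterWidth a δ)
    (hmono : ∀ j < n, c j < c (j + 1))
    (hflip : ∀ k, (∃ z : ℤ, b * h28 a k = z) → ∃ i ≤ n, c i = -(phiForm δ k / h28 a k))
    {S : ℕ → Finset (Fin 28)}
    (hS : ∀ i, 0 < i → i < n → ∀ k, (∃ z : ℤ, b * h28 a k = z) → c i = -(phiForm δ k / h28 a k) → k ∈ S i)
    (q : ℝ) :
    |germR a δ η b + germL a δ η b + germR a (-δ) η b + germL a (-δ) η b| ≤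
      ∑ i ∈ Finset.Ico 1 n, |c i - q| * (S i).card := by
  obtain ⟨J, hJ, hsum, hR⟩ := germ_symm_eq_intComb hpos hb δ hη h1 h2 ht ht1 ht2 hn hc0 hcn hmono hflip hS
  have hsumR : ∑ i ∈ Finset.Ico 1 n, (J i : ℝ) = 0 := by exact_mod_cast hsum
  have e : ∑ i ∈ Finset.Ico 1 n, c i * (J i : ℝ) = ∑ i ∈ Finset.Ico 1 n, (c i - q) * (J i : ℝ) := by
    have : ∑ i ∈ Finset.Ico 1 n, (c i - q) * (J i : ℝ) =
        ∑ i ∈ Finset.Ico 1 n, c i * (J i : ℝ) - q * ∑ i ∈ Finset.Ico 1 n, (J i : ℝ) := by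
      rw [Finset.mul_sum, ← Finset.sum_sub_distrib]
      exact Finset.sum_congr rfl fun i _ => by ring
    rw [this, hsumR, mul_zero, sub_zero]
  rw [hR, e]
  refine (Finset.abs_sum_le_sum_abs _ _).trans (Finset.sum_le_sum fun i hi => ?_)
  obtain ⟨hi0, hin⟩ := Finset.mem_Ico.mp hi
  rw [abs_mul]
  refine mul_le_mul_of_nonneg_left ?_ (abs_nonneg _)
  have := hJ i hi0 hin
  rw [← Int.cast_abs]
  exact_mod_cast this

end Summit.KontsevichZagierPeriods.Zeta5Search.Barrier.ConeGamma

end
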